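import Mathlib
import Literature.Geometry.Lorentzian.KerrSchildCoord
import Literature.Geometry.Lorentzian.KerrConvergence
import Literature.Geometry.Lorentzian.KerrSchildNullBicharacteristic
import Summits.FinalStateConjecture.FinalStateConjecture.Theorems.ClusterCompletenessRecedingDopplerBudgetAlgebra
import Summits.FinalStateConjecture.FinalStateConjecture.Theorems.ClusterCompletenessRecedingDopplerBudgetField
import Summits.FinalStateConjecture.FinalStateConjecture.Theorems.ClusterCompletenessRecedingDopplerBudgetZones

/-!
# Route ClusterCompleteness — `RecedingDopplerBudget`: analysis along one null bicharacteristic, I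

Helper file for the support item `stmt-FinalStateConjecture-15025`
(`Summit.FinalStateConjecture.FinalStateConjecture.Theses.ClusterCompleteness.RecedingDopplerBudget`).

For a bicharacteristic `(x, ξ)` of the patched field `G` on the parameter interval `[0, S]` that
stays outside all horizons, starts in the exactly flat region with `−ξ₀(0) > 0`:

* bridges from the item's inline `G` to the rank-one-sum lemmas (`field_symm`, `field_sum_sum`);
* `rᵢ(qᵢ x(s)) > 0` along the ray (`radius_pos_of_horizon`), so `G` is smooth there and **the
  symbol is conserved**: `∑ G^{μν}(x(s)) ξ_μ(s) ξ_ν(s) = 0` on `[0, S]` (`null_on`,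
  `KerrSchild.IsBicharacteristicOn.isNullBicharacteristicOn_of_null`);
* **the momentum never vanishes** (`momentum_ne_zero`): `‖ξ̇‖ ≤ K‖ξ‖` along the compact ray
  (continuity of `∂G` at the curve), so a zero of `ξ` would propagate back to `s = 0` by
  Grönwall's inequality (`norm_le_gronwallBound_of_norm_deriv_right_le`), against `ξ₀(0) ≠ 0`.
-/

noncomputable section

open Literature.Geometry.Lorentzian Set Filter
open scoped Topology

namespace Summit.FinalStateConjecture.FinalStateConjecture.Theorems.RecedingDoppler

section Ray

variable {N : ℕ} {M a : Fin N → ℝ} {Λ : Fin N → lorentzGroup} {p : Fin N → E3} {u : Fin N → E4}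
  {q : Fin N → E4 → E4} {G : E4 → Fin 4 → Fin 4 → ℝ} {S : ℝ} {x ξ : ℝ → E4}

/-! ### Bridges to the rank-one algebra -/

/-- The item's field is symmetric. [folklore] -/
theorem field_symm
    (hG : ∀ x μ ν, G x μ ν = Minkowski.bilin (E4.basisVector μ) (E4.basisVector ν) -
      ∑ i, Real.smoothTransition (2 - Kerr.radius (a i) (q i x) / (8 * M i)) *
        (2 * Kerr.scalarH (M i) (a i) (q i x)) *
        ((Λ i : E4 ≃L[ℝ] E4) (Kerr.nullVector (a i) (q i x))) μ *
        ((Λ i : E4 ≃L[ℝ] E4) (Kerr.nullVector (a i) (q i x))) ν) (y : E4) (μ ν : Fin 4) :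
    G y μ ν = G y ν μ :=
  rankOne_symm (c := fun i x ↦ Real.smoothTransition (2 - Kerr.radius (a i) (q i x) / (8 * M i)) *
      (2 * Kerr.scalarH (M i) (a i) (q i x)))
    (L := fun i x ↦ (Λ i : E4 ≃L[ℝ] E4) (Kerr.nullVector (a i) (q i x))) hG y μ ν

/-- The item's field contracts as `∑ G ξ ζ = η(ξ, ζ) − ∑ᵢ cᵢ (Lᵢ·ξ)(Lᵢ·ζ)`. [folklore] -/
theorem field_sum_sum
    (hG : ∀ x μ ν, G x μ ν = Minkowski.bilin (E4.basisVector μ) (E4.basisVector ν) -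
      ∑ i, Real.smoothTransition (2 - Kerr.radius (a i) (q i x) / (8 * M i)) *
        (2 * Kerr.scalarH (M i) (a i) (q i x)) *
        ((Λ i : E4 ≃L[ℝ] E4) (Kerr.nullVector (a i) (q i x))) μ *
        ((Λ i : E4 ≃L[ℝ] E4) (Kerr.nullVector (a i) (q i x))) ν) (y ζ ζ' : E4) :
    ∑ μ, ∑ ν, G y μ ν * ζ μ * ζ' ν = Minkowski.bilin ζ ζ' -
      ∑ i, Real.smoothTransition (2 - Kerr.radius (a i) (q i y) / (8 * M i)) *
        (2 * Kerr.scalarH (M i) (a i) (q i y)) *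
        (∑ μ, ((Λ i : E4 ≃L[ℝ] E4) (Kerr.nullVector (a i) (q i y))) μ * ζ μ) *
        (∑ ν, ((Λ i : E4 ≃L[ℝ] E4) (Kerr.nullVector (a i) (q i y))) ν * ζ' ν) :=
  sum_sum_rankOne (c := fun i x ↦ Real.smoothTransition (2 - Kerr.radius (a i) (q i x) / (8 * M i)) *
      (2 * Kerr.scalarH (M i) (a i) (q i x)))
    (L := fun i x ↦ (Λ i : E4 ≃L[ℝ] E4) (Kerr.nullVector (a i) (q i x))) hG y ζ ζ'

/-- At an exactly flat point the symbol is `η(ξ, ξ)`. [folklore] -/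
theorem field_sum_sum_of_flat (hM : ∀ i, 0 < M i)
    (hG : ∀ x μ ν, G x μ ν = Minkowski.bilin (E4.basisVector μ) (E4.basisVector ν) -
      ∑ i, Real.smoothTransition (2 - Kerr.radius (a i) (q i x) / (8 * M i)) *
        (2 * Kerr.scalarH (M i) (a i) (q i x)) *
        ((Λ i : E4 ≃L[ℝ] E4) (Kerr.nullVector (a i) (q i x))) μ *
        ((Λ i : E4 ≃L[ℝ] E4) (Kerr.nullVector (a i) (q i x))) ν) {y : E4}
    (hy : ∀ i, 16 * M i ≤ Kerr.radius (a i) (q i y)) (ζ ζ' : E4) :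
    ∑ μ, ∑ ν, G y μ ν * ζ μ * ζ' ν = Minkowski.bilin ζ ζ' := by
  simp only [field_eq_minkowski_of_flat hM hG hy, sum_sum_minkowski_basisVector]

/-- At an exactly flat point the velocity is `ẋ^μ = ∑_ν η^{μν} ξ_ν`; time component `−ξ₀`.
[folklore] -/
theorem velocity_zero_of_flat' (hM : ∀ i, 0 < M i)
    (hG : ∀ x μ ν, G x μ ν = Minkowski.bilin (E4.basisVector μ) (E4.basisVector ν) -
      ∑ i, Real.smoothTransition (2 - Kerr.radius (a i) (q i x) / (8 * M i)) *
        (2 * Kerr.scalarH (M i) (a i) (q i x)) *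
        ((Λ i : E4 ≃L[ℝ] E4) (Kerr.nullVector (a i) (q i x))) μ *
        ((Λ i : E4 ≃L[ℝ] E4) (Kerr.nullVector (a i) (q i x))) ν) {y : E4}
    (hy : ∀ i, 16 * M i ≤ Kerr.radius (a i) (q i y)) (ζ : E4) :
    ∑ ν, G y 0 ν * ζ ν = -(ζ 0) := by
  have hflat : ∀ ν, G y 0 ν = Kerr.etaComp 0 ν := fun ν ↦ by
    rw [field_eq_minkowski_of_flat hM hG hy, Kerr.minkowski_bilin_basisVector]
  simp only [hflat]
  exact KerrSchild.sum_etaComp_zero_mul ζ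

/-! ### Smoothness along the ray and conservation of the symbol -/

/-- Outside the horizons the rest-frame radii are positive: `r > r₊ = M + √(M² − a²) ≥ M > 0`.
[folklore] -/
theorem radius_pos_of_horizon {Mi ai : ℝ} (hM : 0 < Mi) {y : E4}
    (h : Kerr.rPlus Mi ai < Kerr.radius ai y) : 0 < Kerr.radius ai y := by
  refine lt_trans ?_ h
  unfold Kerr.rPlus
  have := Real.sqrt_nonneg (Mi ^ 2 - ai ^ 2)
  linarith

/-- **The symbol vanishes along the whole ray**: a bicharacteristic of the patched field on
`[0, S]` outside the horizons which is null at `s = 0` is null at every `s ∈ [0, S]`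
(Chandrasekhar 1983, Ch. 7 §61 (67)–(68), via `isNullBicharacteristicOn_of_null`). [folklore] -/
theorem null_on (hM : ∀ i, 0 < M i)
    (hq : ∀ i x, q i x = poincareInv (Λ i) (E4.ofTimeSpace 0 (p i)) x)
    (hG : ∀ x μ ν, G x μ ν = Minkowski.bilin (E4.basisVector μ) (E4.basisVector ν) -
      ∑ i, Real.smoothTransition (2 - Kerr.radius (a i) (q i x) / (8 * M i)) *
        (2 * Kerr.scalarH (M i) (a i) (q i x)) *
        ((Λ i : E4 ≃L[ℝ] E4) (Kerr.nullVector (a i) (q i x))) μ *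
        ((Λ i : E4 ≃L[ℝ] E4) (Kerr.nullVector (a i) (q i x))) ν)
    (hbi : KerrSchild.IsBicharacteristicOn G x ξ (Icc 0 S))
    (hhor : ∀ s ∈ Icc 0 S, ∀ i, Kerr.rPlus (M i) (a i) < Kerr.radius (a i) (q i (x s)))
    (hnull0 : ∑ μ, ∑ ν, G (x 0) μ ν * ξ 0 μ * ξ 0 ν = 0) (hS : 0 ≤ S) :
    ∀ s ∈ Icc 0 S, ∑ μ, ∑ ν, G (x s) μ ν * ξ s μ * ξ s ν = 0 :=
  (hbi.isNullBicharacteristicOn_of_null (convex_Icc 0 S)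
    (fun s _ μ ν ↦ field_symm hG (x s) μ ν)
    (fun s hs μ ν ↦ (contDiffAt_field hq hG
      (fun i ↦ radius_pos_of_horizon (hM i) (hhor s hs i)) μ ν (n := 1)).differentiableAt
        one_ne_zero)
    (left_mem_Icc.2 hS) hnull0).null

/-! ### The momentum never vanishes (Grönwall) -/

/-- `|ζ_μ| ≤ ‖ζ‖` for the Euclidean norm of `E4`. [folklore] -/
theorem abs_apply_le_norm (ζ : E4) (μ : Fin 4) : |ζ μ| ≤ ‖ζ‖ := by
  have h : ‖ζ‖ ^ 2 = ∑ ν, ζ ν ^ 2 := by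
    rw [EuclideanSpace.real_norm_sq_eq]
  have h1 : ζ μ ^ 2 ≤ ∑ ν, ζ ν ^ 2 :=
    Finset.single_le_sum (f := fun ν ↦ ζ ν ^ 2) (fun ν _ ↦ sq_nonneg _) (Finset.mem_univ μ)
  refine (sq_le_sq₀ (abs_nonneg _) (norm_nonneg _)).mp ?_
  rw [sq_abs, h]
  exact h1

/-- **A uniform bound for the coordinate derivatives of `G` along the ray**: `s ↦ ∂_κG^{μν}(x(s))`
is continuous on the compact `[0, S]` (the components are `C¹` at the curve, which is
continuous), hence bounded. [folklore] -/
theorem exists_bound_fderiv_field (hM : ∀ i, 0 < M i)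
    (hq : ∀ i x, q i x = poincareInv (Λ i) (E4.ofTimeSpace 0 (p i)) x)
    (hG : ∀ x μ ν, G x μ ν = Minkowski.bilin (E4.basisVector μ) (E4.basisVector ν) -
      ∑ i, Real.smoothTransition (2 - Kerr.radius (a i) (q i x) / (8 * M i)) *
        (2 * Kerr.scalarH (M i) (a i) (q i x)) *
        ((Λ i : E4 ≃L[ℝ] E4) (Kerr.nullVector (a i) (q i x))) μ *
        ((Λ i : E4 ≃L[ℝ] E4) (Kerr.nullVector (a i) (q i x))) ν)
    (hbi : KerrSchild.IsBicharacteristicOn G x ξ (Icc 0 S))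
    (hhor : ∀ s ∈ Icc 0 S, ∀ i, Kerr.rPlus (M i) (a i) < Kerr.radius (a i) (q i (x s))) :
    ∃ B : ℝ, ∀ s ∈ Icc 0 S, ∀ κ μ ν,
      |fderiv ℝ (fun y ↦ G y μ ν) (x s) (E4.basisVector κ)| ≤ B := by
  -- the continuous function `s ↦ ∑_{κμν} |∂_κ G^{μν}(x s)|`
  have hxc : ContinuousOn x (Icc 0 S) := fun s hs ↦ (hbi.continuousAt hs).1.continuousWithinAt
  have hcomp : ∀ κ μ ν, ContinuousOn
      (fun s ↦ fderiv ℝ (fun y ↦ G y μ ν) (x s) (E4.basisVector κ)) (Icc 0 S) := by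
    intro κ μ ν s hs
    have hcd : ContDiffAt ℝ 1 (fun y ↦ G y μ ν) (x s) :=
      contDiffAt_field hq hG (fun i ↦ radius_pos_of_horizon (hM i) (hhor s hs i)) μ ν
    have hfd : ContinuousAt (fderiv ℝ (fun y ↦ G y μ ν)) (x s) :=
      (hcd.fderiv_right (m := 0) le_rfl).continuousAt
    have h1 : ContinuousWithinAt (fun σ ↦ fderiv ℝ (fun y ↦ G y μ ν) (x σ)) (Icc 0 S) s :=
      hfd.comp_continuousWithinAt (hxc s hs)
    exact h1.clm_apply continuousWithinAt_const
  have hsum : ContinuousOn (fun s ↦ ∑ κ, ∑ μ, ∑ ν,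
      |fderiv ℝ (fun y ↦ G y μ ν) (x s) (E4.basisVector κ)|) (Icc 0 S) :=
    continuousOn_finsetSum _ fun κ _ ↦ continuousOn_finsetSum _ fun μ _ ↦
      continuousOn_finsetSum _ fun ν _ ↦ (hcomp κ μ ν).abs
  obtain ⟨B, hB⟩ := isCompact_Icc.exists_bound_of_continuousOn hsum
  refine ⟨B, fun s hs κ μ ν ↦ ?_⟩
  have h1 := hB s hs
  rw [Real.norm_eq_abs, abs_of_nonneg (Finset.sum_nonneg fun κ _ ↦ Finset.sum_nonneg
    fun μ _ ↦ Finset.sum_nonneg fun ν _ ↦ abs_nonneg _)] at h1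
  refine le_trans ?_ h1
  refine le_trans ?_ (Finset.single_le_sum (f := fun κ ↦ ∑ μ, ∑ ν,
    |fderiv ℝ (fun y ↦ G y μ ν) (x s) (E4.basisVector κ)|)
    (fun κ _ ↦ Finset.sum_nonneg fun μ _ ↦ Finset.sum_nonneg fun ν _ ↦ abs_nonneg _)
    (Finset.mem_univ κ))
  refine le_trans ?_ (Finset.single_le_sum (f := fun μ ↦ ∑ ν,
    |fderiv ℝ (fun y ↦ G y μ ν) (x s) (E4.basisVector κ)|)
    (fun μ _ ↦ Finset.sum_nonneg fun ν _ ↦ abs_nonneg _) (Finset.mem_univ μ))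
  exact Finset.single_le_sum (f := fun ν ↦ |fderiv ℝ (fun y ↦ G y μ ν) (x s) (E4.basisVector κ)|)
    (fun ν _ ↦ abs_nonneg _) (Finset.mem_univ ν)

/-- **Linear growth bound for the momentum equation**: with `|∂_κG^{μν}| ≤ B` along the ray and
`‖ξ‖ ≤ R`, the momentum derivative `ξ̇ = ∑_κ (−½ ∑ ∂_κG ξ ξ) ∂_κ` satisfies `‖ξ̇‖ ≤ 32BR‖ξ‖`.
[folklore] -/
theorem norm_momentum_deriv_le {B R : ℝ} {D : Fin 4 → Fin 4 → Fin 4 → ℝ} {ζ : E4}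
    (hB : ∀ κ μ ν, |D κ μ ν| ≤ B) (hR : ‖ζ‖ ≤ R) :
    ‖∑ κ, (-(1 / 2) * ∑ μ, ∑ ν, D κ μ ν * ζ μ * ζ ν) • E4.basisVector κ‖ ≤
      32 * B * R * ‖ζ‖ := by
  have hB0 : 0 ≤ B := le_trans (abs_nonneg _) (hB 0 0 0)
  have hterm : ∀ κ, |(-(1 / 2) * ∑ μ, ∑ ν, D κ μ ν * ζ μ * ζ ν)| ≤ 8 * B * ‖ζ‖ ^ 2 := by
    intro κ
    rw [abs_mul, abs_neg, abs_of_pos (by norm_num : (0:ℝ) < 1 / 2)]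
    have h1 : |∑ μ, ∑ ν, D κ μ ν * ζ μ * ζ ν| ≤ ∑ _μ : Fin 4, ∑ _ν : Fin 4, B * ‖ζ‖ * ‖ζ‖ := by
      refine (Finset.abs_sum_le_sum_abs _ _).trans (Finset.sum_le_sum fun μ _ ↦ ?_)
      refine (Finset.abs_sum_le_sum_abs _ _).trans (Finset.sum_le_sum fun ν _ ↦ ?_)
      rw [abs_mul, abs_mul]
      exact mul_le_mul (mul_le_mul (hB κ μ ν) (abs_apply_le_norm ζ μ) (abs_nonneg _) hB0)
        (abs_apply_le_norm ζ ν) (abs_nonneg _) (mul_nonneg hB0 (norm_nonneg _))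
    simp only [Finset.sum_const, Finset.card_univ, Fintype.card_fin, nsmul_eq_mul,
      Nat.cast_ofNat] at h1
    nlinarith [h1, norm_nonneg ζ]
  calc ‖∑ κ, (-(1 / 2) * ∑ μ, ∑ ν, D κ μ ν * ζ μ * ζ ν) • E4.basisVector κ‖
      ≤ ∑ κ, ‖(-(1 / 2) * ∑ μ, ∑ ν, D κ μ ν * ζ μ * ζ ν) • E4.basisVector κ‖ :=
        norm_sum_le _ _
    _ ≤ ∑ _κ : Fin 4, 8 * B * ‖ζ‖ ^ 2 := Finset.sum_le_sum fun κ _ ↦ by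
        rw [norm_smul, Real.norm_eq_abs]
        have : ‖(E4.basisVector κ : E4)‖ = 1 := by
          simp [E4.basisVector]
        rw [this, mul_one]
        exact hterm κ
    _ = 32 * B * ‖ζ‖ * ‖ζ‖ := by
        simp only [Finset.sum_const, Finset.card_univ, Fintype.card_fin, nsmul_eq_mul,
          Nat.cast_ofNat]; ring
    _ ≤ 32 * B * R * ‖ζ‖ := by
        have := norm_nonneg ζ
        gcongr

/-- **The momentum of the ray never vanishes.** Along a bicharacteristic of the patched field on
`[0, S]` outside the horizons with `ξ₀(0) ≠ 0`, `ξ(s) ≠ 0` for every `s ∈ [0, S]`: a zero at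
`s₀` would give `ξ ≡ 0` on `[0, s₀]` by Grönwall's inequality applied backwards from `s₀` to the
linear bound `‖ξ̇‖ ≤ K‖ξ‖` (uniqueness for the momentum equation; Hartman, ODE, Ch. III).
[folklore] -/
theorem momentum_ne_zero (hM : ∀ i, 0 < M i)
    (hq : ∀ i x, q i x = poincareInv (Λ i) (E4.ofTimeSpace 0 (p i)) x)
    (hG : ∀ x μ ν, G x μ ν = Minkowski.bilin (E4.basisVector μ) (E4.basisVector ν) -
      ∑ i, Real.smoothTransition (2 - Kerr.radius (a i) (q i x) / (8 * M i)) *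
        (2 * Kerr.scalarH (M i) (a i) (q i x)) *
        ((Λ i : E4 ≃L[ℝ] E4) (Kerr.nullVector (a i) (q i x))) μ *
        ((Λ i : E4 ≃L[ℝ] E4) (Kerr.nullVector (a i) (q i x))) ν)
    (hbi : KerrSchild.IsBicharacteristicOn G x ξ (Icc 0 S))
    (hhor : ∀ s ∈ Icc 0 S, ∀ i, Kerr.rPlus (M i) (a i) < Kerr.radius (a i) (q i (x s)))
    (hE0 : 0 < -(ξ 0 0)) : ∀ s ∈ Icc 0 S, ξ s ≠ 0 := by
  intro s₀ hs₀ hzero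
  obtain ⟨B, hB⟩ := exists_bound_fderiv_field hM hq hG hbi hhor
  -- bound on `‖ξ‖` along the compact ray
  have hξc : ContinuousOn ξ (Icc 0 S) := fun s hs ↦ (hbi.continuousAt hs).2.continuousWithinAt
  obtain ⟨R, hR⟩ := isCompact_Icc.exists_bound_of_continuousOn hξc
  -- the reversed momentum `f(t) = ξ(s₀ − t)` on `[0, s₀]`
  set K := 32 * B * R with hK
  set f : ℝ → E4 := fun t ↦ ξ (s₀ - t) with hf
  have hmem : ∀ t ∈ Icc 0 s₀, s₀ - t ∈ Icc 0 S := fun t ht ↦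
    ⟨by linarith [ht.2], by linarith [ht.1, hs₀.2]⟩
  have hfc : ContinuousOn f (Icc 0 s₀) := by
    refine hξc.comp (continuousOn_const.sub continuousOn_id) fun t ht ↦ hmem t ht
  have hderiv : ∀ t ∈ Ico 0 s₀, HasDerivWithinAt f
      (-(∑ κ, (-(1 / 2) * ∑ μ, ∑ ν, fderiv ℝ (fun y ↦ G y μ ν) (x (s₀ - t)) (E4.basisVector κ) *
        ξ (s₀ - t) μ * ξ (s₀ - t) ν) • E4.basisVector κ)) (Ici t) t := by
    intro t ht
    have h1 := hbi.hasDerivAt_momentum_vec (hmem t (Ico_subset_Icc_self ht))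
    have h2 := h1.comp_const_sub s₀ t
    exact h2.hasDerivWithinAt
  have hbound : ∀ t ∈ Ico 0 s₀, ‖-(∑ κ, (-(1 / 2) * ∑ μ, ∑ ν,
      fderiv ℝ (fun y ↦ G y μ ν) (x (s₀ - t)) (E4.basisVector κ) *
        ξ (s₀ - t) μ * ξ (s₀ - t) ν) • E4.basisVector κ)‖ ≤ K * ‖f t‖ + 0 := by
    intro t ht
    rw [norm_neg, add_zero, hK]
    exact norm_momentum_deriv_le (D := fun κ μ ν ↦
      fderiv ℝ (fun y ↦ G y μ ν) (x (s₀ - t)) (E4.basisVector κ))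
      (hB (s₀ - t) (hmem t (Ico_subset_Icc_self ht))) (hR _ (hmem t (Ico_subset_Icc_self ht)))
  have hf0 : ‖f 0‖ ≤ 0 := by simp [hf, hzero]
  have hgr := norm_le_gronwallBound_of_norm_deriv_right_le hfc hderiv hf0 hbound s₀
    ⟨hs₀.1, le_rfl⟩
  rw [gronwallBound_ε0_δ0, norm_le_zero_iff] at hgr
  have : ξ 0 = 0 := by simpa [hf] using hgr
  have h00 : ξ 0 0 = 0 := by rw [this]; rfl
  linarith

end Ray

end Summit.FinalStateConjecture.FinalStateConjecture.Theorems.RecedingDoppler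

end
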